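import Literature.Analysis.OperatorTheory.PositiveKernelSpectralTraceTwoSucc
import HarnessLib

/-!
# Covariance bound for a transfer operator expanded in an eigenbasis — PROVED

Topic `Literature/Analysis/OperatorTheory`; companion of `PositiveKernelSpectralTrace{,Two}.lean` (trace formulas for the
cyclic integrals of a kernel chain as spectral sums).  Pure Hilbert-space / `tsum` bookkeeping turning those spectral sums
into a bound on the normalised connected correlation (written for the abstract trace-formula clustering step of crux
`FibreAnchor`, route `QuantumFields/ContractibleFibre`, stub `stub_traceFormulaClustering`; Mathlib only, no definitions):

* `norm_le_of_eigenbasis` — a self-adjoint operator with a Hilbert basis of eigenvectors and `|λᵢ| ≤ L` has `‖T‖ ≤ L`;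
* `sum_abs_inner_mul_inner_le`, `tsum_abs_inner_mul_inner_le` — the Bessel–Cauchy–Schwarz bound
  `Σⱼ |⟪x, bⱼ⟫| |⟪bⱼ, y⟫| ≤ ‖x‖ ‖y‖`;
* `abs_tsum_ite_le`, `abs_sub_le_of_hasSum_mul` — splitting off the vacuum index `i₀` in spectral sums;
* `eigenbasis_cov_bound` (**main**) — the covariance bound `|S₂/Z − (S₁/Z)(S₁'/Z)| ≤ 2θᵃ + 6R` for the normalised
  two-insertion / one-insertion / vacuum spectral sums of a transfer operator with top eigenvalue `λ_{i₀}`, spectral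
  ratio `λᵢ ≤ θ λ_{i₀}` off `i₀`, and trace excess `Σ_{i ≠ i₀} (λᵢ/λ_{i₀})ᵇ ≤ R ≤ 1` on the LONG arc `b` only
  (Glimm–Jaffe 1987 §6.1; Osterwalder–Seiler 1978 §2: expand `Tr(𝒳₁ Tᵃ 𝒳₂ Tᵇ)` in the eigenbasis, split `i = i₀`
  on the long arc, Cauchy–Schwarz + Bessel for the rows). [folklore]
-/

set_option autoImplicit false

noncomputable section

namespace Literature.Analysis.OperatorTheory

open scoped BigOperators RealInnerProductSpace ENNReal
open _root_.MeasureTheory Filter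

section Hilbert

variable {E : Type*} [NormedAddCommGroup E] [InnerProductSpace ℝ E] [CompleteSpace E] {ι : Type*}

/-- A self-adjoint operator with a Hilbert basis of eigenvectors `T bᵢ = λᵢ bᵢ`, `|λᵢ| ≤ L`, has `‖T‖ ≤ L`
(Parseval: `‖Tφ‖² = Σ λᵢ² ⟪bᵢ, φ⟫² ≤ L² ‖φ‖²`). [folklore] -/
theorem norm_le_of_eigenbasis (b : HilbertBasis ι ℝ E) {T : E →L[ℝ] E} (hT : IsSelfAdjoint T) {lam : ι → ℝ}
    (hb : ∀ i, T (b i) = lam i • b i) {L : ℝ} (hL : 0 ≤ L) (hle : ∀ i, |lam i| ≤ L) : ‖T‖ ≤ L := by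
  refine ContinuousLinearMap.opNorm_le_bound _ hL fun φ => ?_
  have h1 : HasSum (fun i => ⟪T φ, b i⟫ * ⟪b i, T φ⟫) (‖T φ‖ ^ 2) := by
    rw [← real_inner_self_eq_norm_sq]
    exact b.hasSum_inner_mul_inner (T φ) (T φ)
  have h2 : HasSum (fun i => L ^ 2 * (⟪φ, b i⟫ * ⟪b i, φ⟫)) (L ^ 2 * ‖φ‖ ^ 2) := by
    rw [← real_inner_self_eq_norm_sq]
    exact (b.hasSum_inner_mul_inner φ φ).mul_left _
  have hcoef : ∀ i, ⟪b i, T φ⟫ = lam i * ⟪b i, φ⟫ := fun i => by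
    have hs := hT.isSymmetric (b i) φ
    simp only [ContinuousLinearMap.coe_coe] at hs
    rw [← hs, hb, real_inner_smul_left]
  have h3 : ‖T φ‖ ^ 2 ≤ L ^ 2 * ‖φ‖ ^ 2 := by
    refine hasSum_le (fun i => ?_) h1 h2
    rw [real_inner_comm (b i) (T φ), hcoef i, real_inner_comm (b i) φ]
    have hsq : lam i ^ 2 ≤ L ^ 2 := by
      have h := hle i
      rw [← sq_abs (lam i)]
      exact pow_le_pow_left₀ (abs_nonneg _) h 2
    nlinarith [mul_self_nonneg ⟪b i, φ⟫, hsq]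
  have h4 : ‖T φ‖ ^ 2 ≤ (L * ‖φ‖) ^ 2 := by rw [mul_pow]; exact h3
  exact (pow_le_pow_iff_left₀ (norm_nonneg _) (mul_nonneg hL (norm_nonneg _)) two_ne_zero).1 h4

omit [CompleteSpace E] in
/-- Finite Bessel–Cauchy–Schwarz: `Σ_{j ∈ s} |⟪x, bⱼ⟫| |⟪bⱼ, y⟫| ≤ ‖x‖ ‖y‖`. [folklore] -/
theorem sum_abs_inner_mul_inner_le (b : HilbertBasis ι ℝ E) (x y : E) (s : Finset ι) :
    ∑ j ∈ s, |⟪x, b j⟫| * |⟪b j, y⟫| ≤ ‖x‖ * ‖y‖ := by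
  have hcs := Finset.sum_mul_sq_le_sq_mul_sq s (fun j => |⟪x, b j⟫|) (fun j => |⟪b j, y⟫|)
  have hx : ∑ j ∈ s, |⟪x, b j⟫| ^ 2 ≤ ‖x‖ ^ 2 := by
    have h := b.orthonormal.sum_inner_products_le x (s := s)
    refine le_trans (le_of_eq (Finset.sum_congr rfl fun j _ => ?_)) h
    rw [real_inner_comm x (b j), Real.norm_eq_abs]
  have hy : ∑ j ∈ s, |⟪b j, y⟫| ^ 2 ≤ ‖y‖ ^ 2 := by
    have h := b.orthonormal.sum_inner_products_le y (s := s)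
    refine le_trans (le_of_eq (Finset.sum_congr rfl fun j _ => ?_)) h
    rw [Real.norm_eq_abs]
  have h0 : 0 ≤ ∑ j ∈ s, |⟪x, b j⟫| * |⟪b j, y⟫| :=
    Finset.sum_nonneg fun j _ => mul_nonneg (abs_nonneg _) (abs_nonneg _)
  have h1 : (∑ j ∈ s, |⟪x, b j⟫| * |⟪b j, y⟫|) ^ 2 ≤ (‖x‖ * ‖y‖) ^ 2 := by
    calc (∑ j ∈ s, |⟪x, b j⟫| * |⟪b j, y⟫|) ^ 2
        ≤ (∑ j ∈ s, |⟪x, b j⟫| ^ 2) * ∑ j ∈ s, |⟪b j, y⟫| ^ 2 := hcs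
      _ ≤ ‖x‖ ^ 2 * ‖y‖ ^ 2 := mul_le_mul hx hy (Finset.sum_nonneg fun j _ => sq_nonneg _) (sq_nonneg _)
      _ = (‖x‖ * ‖y‖) ^ 2 := by ring
  exact (pow_le_pow_iff_left₀ h0 (mul_nonneg (norm_nonneg _) (norm_nonneg _)) two_ne_zero).1 h1

omit [CompleteSpace E] in
/-- **Bessel–Cauchy–Schwarz**: `Σⱼ |⟪x, bⱼ⟫| |⟪bⱼ, y⟫|` is summable and at most `‖x‖ ‖y‖`. [folklore] -/
theorem tsum_abs_inner_mul_inner_le (b : HilbertBasis ι ℝ E) (x y : E) :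
    Summable (fun j => |⟪x, b j⟫| * |⟪b j, y⟫|) ∧ ∑' j, |⟪x, b j⟫| * |⟪b j, y⟫| ≤ ‖x‖ * ‖y‖ := by
  have h0 : 0 ≤ fun j => |⟪x, b j⟫| * |⟪b j, y⟫| := fun j => mul_nonneg (abs_nonneg _) (abs_nonneg _)
  exact ⟨summable_of_sum_le h0 (sum_abs_inner_mul_inner_le b x y),
    Real.tsum_le_of_sum_le h0 (sum_abs_inner_mul_inner_le b x y)⟩

/-- Row bound for the matrix elements of two bounded operators in a Hilbert basis:
`Σⱼ |⟪bᵢ, X₁ bⱼ⟫| |⟪bⱼ, X₂ bᵢ⟫| ≤ ‖X₁‖ ‖X₂‖` (and the family is summable). [folklore] -/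
theorem tsum_abs_matrix_row_le (b : HilbertBasis ι ℝ E) (X₁ X₂ : E →L[ℝ] E) (i : ι) :
    Summable (fun j => |⟪b i, X₁ (b j)⟫| * |⟪b j, X₂ (b i)⟫|) ∧
      ∑' j, |⟪b i, X₁ (b j)⟫| * |⟪b j, X₂ (b i)⟫| ≤ ‖X₁‖ * ‖X₂‖ := by
  have h := tsum_abs_inner_mul_inner_le b (ContinuousLinearMap.adjoint X₁ (b i)) (X₂ (b i))
  have he : (fun j => |⟪ContinuousLinearMap.adjoint X₁ (b i), b j⟫| * |⟪b j, X₂ (b i)⟫|) =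
      fun j => |⟪b i, X₁ (b j)⟫| * |⟪b j, X₂ (b i)⟫| := by
    funext j
    rw [ContinuousLinearMap.adjoint_inner_left]
  rw [he] at h
  refine ⟨h.1, h.2.trans ?_⟩
  have h1 : ‖ContinuousLinearMap.adjoint X₁ (b i)‖ ≤ ‖X₁‖ := by
    calc ‖ContinuousLinearMap.adjoint X₁ (b i)‖ ≤ ‖ContinuousLinearMap.adjoint X₁‖ * ‖b i‖ :=
          ContinuousLinearMap.le_opNorm _ _
      _ = ‖X₁‖ := by rw [ContinuousLinearMap.adjoint.norm_map, b.orthonormal.norm_eq_one i, mul_one]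
  have h2 : ‖X₂ (b i)‖ ≤ ‖X₂‖ := by
    calc ‖X₂ (b i)‖ ≤ ‖X₂‖ * ‖b i‖ := ContinuousLinearMap.le_opNorm _ _
      _ = ‖X₂‖ := by rw [b.orthonormal.norm_eq_one i, mul_one]
  exact mul_le_mul h1 h2 (norm_nonneg _) (norm_nonneg _)

omit [CompleteSpace E] in
/-- Diagonal matrix elements are bounded by the operator norm: `|⟪bᵢ, X bᵢ⟫| ≤ ‖X‖`. [folklore] -/
theorem abs_inner_apply_basis_le (b : HilbertBasis ι ℝ E) (X₁ : E →L[ℝ] E) (i : ι) : |⟪b i, X₁ (b i)⟫| ≤ ‖X₁‖ := by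
  have h1 : ‖b i‖ = 1 := b.orthonormal.norm_eq_one i
  calc |⟪b i, X₁ (b i)⟫| ≤ ‖b i‖ * ‖X₁ (b i)‖ := abs_real_inner_le_norm _ _
    _ ≤ ‖b i‖ * (‖X₁‖ * ‖b i‖) := mul_le_mul_of_nonneg_left (X₁.le_opNorm _) (norm_nonneg _)
    _ = ‖X₁‖ := by rw [h1]; ring

end Hilbert

/-! ### Splitting off the vacuum index -/

/-- The off-vacuum part of a dominated family: if `|f i| ≤ g i` for `i ≠ i₀` and `Σ_{i ≠ i₀} g i ≤ R` (with `g`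
summable), then `|Σ' i, ite (i = i₀) 0 (f i)| ≤ R`. [folklore] -/
theorem abs_tsum_ite_le {ι : Type*} [DecidableEq ι] (i₀ : ι) {f g : ι → ℝ} (hg : Summable g)
    (hfg : ∀ i, i ≠ i₀ → |f i| ≤ g i) {R : ℝ}
    (hR : ∑' i, (if i = i₀ then 0 else g i) ≤ R) :
    |∑' i, (if i = i₀ then 0 else f i)| ≤ R := by
  have hg' : Summable fun i => if i = i₀ then 0 else g i := by
    have h := hg.update i₀ 0
    refine h.congr fun i => ?_
    by_cases hi : i = i₀
    · subst hi; simp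
    · simp [hi]
  have hle : ∀ i, ‖(if i = i₀ then 0 else f i)‖ ≤ (if i = i₀ then 0 else g i) := fun i => by
    by_cases hi : i = i₀
    · simp [hi]
    · simp only [hi, if_false, Real.norm_eq_abs]; exact hfg i hi
  have h1 : ‖∑' i, (if i = i₀ then 0 else f i)‖ ≤ ∑' i, (if i = i₀ then 0 else g i) :=
    tsum_of_norm_bounded hg'.hasSum hle
  rw [Real.norm_eq_abs] at h1
  exact h1.trans hR

/-- Splitting off the vacuum index in a one-index spectral sum: if `Σᵢ ρᵢᵐ gᵢ = s` with `|gᵢ| ≤ 1`, `0 ≤ ρᵢ`,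
`ρ_{i₀} = 1` and `Σ_{i ≠ i₀} ρᵢᵐ ≤ R`, then `|s − g_{i₀}| ≤ R`. [folklore] -/
theorem abs_sub_le_of_hasSum_mul {ι : Type*} [DecidableEq ι] (i₀ : ι) {ρ g : ι → ℝ} {m : ℕ} {s R : ℝ}
    (hρ0 : ∀ i, 0 ≤ ρ i) (hρ1 : ρ i₀ = 1) (hg : ∀ i, |g i| ≤ 1) (hsm : Summable fun i => ρ i ^ m)
    (hR : ∑' i, (if i = i₀ then 0 else ρ i ^ m) ≤ R) (hs : HasSum (fun i => ρ i ^ m * g i) s) :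
    |s - g i₀| ≤ R := by
  have hsum : Summable fun i => ρ i ^ m * g i := hs.summable
  have h1 : s = ρ i₀ ^ m * g i₀ + ∑' i, (if i = i₀ then 0 else ρ i ^ m * g i) := by
    rw [← hs.tsum_eq]; exact hsum.tsum_eq_add_tsum_ite i₀
  rw [hρ1, one_pow, one_mul] at h1
  rw [h1, add_sub_cancel_left]
  refine abs_tsum_ite_le i₀ hsm (fun i _ => ?_) hR
  rw [abs_mul, abs_of_nonneg (pow_nonneg (hρ0 i) m)]
  exact mul_le_of_le_one_right (pow_nonneg (hρ0 i) m) (hg i)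

/-- Deleting one term of a summable real family leaves a summable family. [folklore] -/
theorem summable_ite_zero {ι : Type*} [DecidableEq ι] (i₀ : ι) {f : ι → ℝ} (hf : Summable f) :
    Summable fun i => if i = i₀ then 0 else f i := by
  refine (hf.update i₀ 0).congr fun i => ?_
  by_cases hi : i = i₀
  · subst hi; simp
  · simp [hi]

/-! ### The abstract covariance bound -/

/-- **Abstract covariance bound (vacuum + long-arc trace excess + short-arc gap).**  Let `0 ≤ λᵢ ≤ λ_{i₀}`,
`0 < λ_{i₀}`, `λᵢ ≤ θ λ_{i₀}` for `i ≠ i₀`, and `Σᵢ (λᵢ/λ_{i₀})ᵇ ≤ 1 + R` with `0 ≤ R ≤ 1`.  Let `M₁`, `M₂` be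
"matrices" with diagonal `|Mₖ i i| ≤ λ_{i₀}ᵖ` and rows `Σⱼ |M₁ i j| |M₂ j i| ≤ λ_{i₀}^{2p}` (the matrix elements of two
bond operators of norm `≤ λ_{i₀}ᵖ`).  If `S₂ = Σ_{(i,j)} λⱼᵃ λᵢᵇ M₁ i j M₂ j i`, `S₁ = Σ λᵢ^{a+b+p} M₁ i i`,
`S₁' = Σ λᵢ^{a+b+p} M₂ i i` and `Z = Σ λᵢ^{a+b+2p}`, then `|S₂/Z − (S₁/Z)(S₁'/Z)| ≤ 2 θᵃ + 6 R`: the vacuum term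
`(i,j) = (i₀,i₀)` cancels between the two ratios, the row `i = i₀, j ≠ i₀` is `O(θᵃ)` by Cauchy–Schwarz/Bessel, and
all rows `i ≠ i₀` together are `O(Σ_{i≠i₀} (λᵢ/λ_{i₀})ᵇ) = O(R)`. [folklore] -/
theorem eigenbasis_cov_bound {ι : Type*} {lam : ι → ℝ} {i₀ : ι} {M₁ M₂ : ι → ι → ℝ} {θ R : ℝ} {a b p : ℕ}
    (hlam0 : ∀ i, 0 ≤ lam i) (hle : ∀ i, lam i ≤ lam i₀) (hL : 0 < lam i₀)
    (hθ0 : 0 ≤ θ) (hθ : ∀ i, i ≠ i₀ → lam i ≤ θ * lam i₀) (hR0 : 0 ≤ R) (hR1 : R ≤ 1)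
    (hsb : Summable fun i => (lam i / lam i₀) ^ b) (hRb : ∑' i, (lam i / lam i₀) ^ b ≤ 1 + R)
    (hd₁ : ∀ i, |M₁ i i| ≤ lam i₀ ^ p) (hd₂ : ∀ i, |M₂ i i| ≤ lam i₀ ^ p)
    (hrow : ∀ i, Summable (fun j => |M₁ i j| * |M₂ j i|) ∧ ∑' j, |M₁ i j| * |M₂ j i| ≤ (lam i₀ ^ p) ^ 2)
    {S₂ S₁ S₁' Z : ℝ}
    (hS₂ : HasSum (fun q : ι × ι => lam q.2 ^ a * lam q.1 ^ b * M₁ q.1 q.2 * M₂ q.2 q.1) S₂)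
    (hS₁ : HasSum (fun i => lam i ^ (a + b + p) * M₁ i i) S₁)
    (hS₁' : HasSum (fun i => lam i ^ (a + b + p) * M₂ i i) S₁')
    (hZ : HasSum (fun i => lam i ^ (a + b + 2 * p)) Z) :
    |S₂ / Z - S₁ / Z * (S₁' / Z)| ≤ 2 * θ ^ a + 6 * R := by
  classical
  -- normalisation by the top eigenvalue
  set L : ℝ := lam i₀ with hLdef
  set P : ℝ := L ^ p with hPdef
  have hL0 : L ≠ 0 := hL.ne'
  have hP0 : 0 < P := pow_pos hL p
  have hP0' : P ≠ 0 := hP0.ne'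
  set ρ : ι → ℝ := fun i => lam i / L with hρdef
  have hρ0 : ∀ i, 0 ≤ ρ i := fun i => div_nonneg (hlam0 i) hL.le
  have hρ1 : ∀ i, ρ i ≤ 1 := fun i => div_le_one_of_le₀ (hle i) hL.le
  have hρi₀ : ρ i₀ = 1 := div_self hL0
  have hρθ : ∀ i, i ≠ i₀ → ρ i ≤ θ := fun i hi => by
    rw [hρdef]; dsimp only; rw [div_le_iff₀ hL]; exact hθ i hi
  have hlamρ : ∀ (i) (k : ℕ), lam i ^ k = L ^ k * ρ i ^ k := fun i k => by
    rw [hρdef]; dsimp only; rw [div_pow, mul_div_cancel₀ _ (pow_ne_zero k hL0)]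
  have hρa1 : ∀ j, ρ j ^ a ≤ 1 := fun j => pow_le_one₀ (hρ0 j) (hρ1 j)
  have hsbρ : Summable fun i => ρ i ^ b := hsb
  have hRbρ : ∑' i, ρ i ^ b ≤ 1 + R := hRb
  -- off-vacuum sums `Σ_{i ≠ i₀} ρᵢᵐ ≤ R` for `m ≥ b`
  have hoff : ∀ m : ℕ, b ≤ m → (Summable fun i => ρ i ^ m) ∧ ∑' i, (if i = i₀ then 0 else ρ i ^ m) ≤ R := by
    intro m hm
    have hpt : ∀ i, ρ i ^ m ≤ ρ i ^ b := fun i => pow_le_pow_of_le_one (hρ0 i) (hρ1 i) hm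
    have hsm : Summable fun i => ρ i ^ m := hsbρ.of_nonneg_of_le (fun i => pow_nonneg (hρ0 i) m) hpt
    refine ⟨hsm, ?_⟩
    have h1 : ∑' i, (if i = i₀ then 0 else ρ i ^ m) ≤ ∑' i, (if i = i₀ then 0 else ρ i ^ b) :=
      Summable.tsum_le_tsum (fun i => by by_cases hi : i = i₀ <;> simp [hi, hpt i]) (summable_ite_zero i₀ hsm)
        (summable_ite_zero i₀ hsbρ)
    have h2 : ∑' i, (if i = i₀ then 0 else ρ i ^ b) = ∑' i, ρ i ^ b - 1 := by
      rw [hsbρ.tsum_eq_add_tsum_ite i₀, hρi₀, one_pow]; ring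
    linarith
  -- the vacuum sum `z = Z / L^N = 1 + r`, `0 ≤ r ≤ R`
  set N : ℕ := a + b + 2 * p with hNdef
  have hLN : 0 < L ^ N := pow_pos hL N
  have hz : HasSum (fun i => ρ i ^ N) (Z / L ^ N) := by
    refine (hZ.div_const (L ^ N)).congr_fun fun i => ?_
    rw [hlamρ i N, mul_div_cancel_left₀ _ hLN.ne']
  set z : ℝ := Z / L ^ N with hzdef
  have hz1 : 1 ≤ z := by
    have h := le_hasSum hz i₀ (fun j _ => pow_nonneg (hρ0 j) N)
    rwa [hρi₀, one_pow] at h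
  have hzR : z ≤ 1 + R := by
    obtain ⟨hsN, hoffN⟩ := hoff N (by omega)
    have h1 : z = 1 + ∑' i, (if i = i₀ then 0 else ρ i ^ N) := by
      rw [← hz.tsum_eq, hsN.tsum_eq_add_tsum_ite i₀, hρi₀, one_pow]
    linarith
  -- the one-insertion sums `s = α + e`, `|e| ≤ R`
  have hone : ∀ {M : ι → ι → ℝ} {S : ℝ}, (∀ i, |M i i| ≤ P) →
      HasSum (fun i => lam i ^ (a + b + p) * M i i) S → |S / L ^ N - M i₀ i₀ / P| ≤ R := by
    intro M S hd hS
    have hLk : L ^ N = L ^ (a + b + p) * P := by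
      rw [hPdef, ← pow_add]; congr 1; omega
    have hS' : HasSum (fun i => ρ i ^ (a + b + p) * (M i i / P)) (S / L ^ N) := by
      refine (hS.div_const (L ^ N)).congr_fun fun i => ?_
      rw [hlamρ i (a + b + p), hLk, mul_assoc, mul_div_mul_left _ _ (pow_ne_zero _ hL0), mul_div_assoc]
    obtain ⟨hsm, hoffm⟩ := hoff (a + b + p) (by omega)
    exact abs_sub_le_of_hasSum_mul i₀ hρ0 hρi₀ (fun i => by
      rw [abs_div, abs_of_pos hP0, div_le_one hP0]; exact hd i) hsm hoffm hS'
  have he₂ := hone hd₁ hS₁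
  have he₃ := hone hd₂ hS₁'
  -- the two-insertion sum: normalised matrix `m i j = M₁ i j M₂ j i / P²`, rows `Σⱼ |m i j| ≤ 1`
  set m : ι → ι → ℝ := fun i j => M₁ i j * M₂ j i / P ^ 2 with hmdef
  have hmrow : ∀ i, Summable (fun j => |m i j|) ∧ ∑' j, |m i j| ≤ 1 := by
    intro i
    obtain ⟨hs, hle1⟩ := hrow i
    have heq : (fun j => |m i j|) = fun j => |M₁ i j| * |M₂ j i| / P ^ 2 := by
      funext j; rw [hmdef]; dsimp only; rw [abs_div, abs_mul, abs_of_pos (pow_pos hP0 2)]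
    rw [heq]
    refine ⟨hs.div_const _, ?_⟩
    rw [tsum_div_const, div_le_one (pow_pos hP0 2)]
    exact hle1
  have hsm : ∀ i, Summable fun j => ρ j ^ a * m i j := fun i =>
    Summable.of_norm_bounded (hmrow i).1 fun j => by
      rw [Real.norm_eq_abs, abs_mul, abs_of_nonneg (pow_nonneg (hρ0 j) a)]
      exact mul_le_of_le_one_left (abs_nonneg _) (hρa1 j)
  have hF : HasSum (fun q : ι × ι => ρ q.2 ^ a * ρ q.1 ^ b * m q.1 q.2) (S₂ / L ^ N) := by
    have hLk : L ^ N = L ^ a * L ^ b * P ^ 2 := by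
      rw [hPdef, ← pow_mul, ← pow_add, ← pow_add, hNdef]; ring_nf
    refine (hS₂.div_const (L ^ N)).congr_fun fun q => ?_
    rw [hlamρ q.2 a, hlamρ q.1 b, hLk, hmdef]
    dsimp only
    field_simp
  have hfib : ∀ i, HasSum (fun j => ρ j ^ a * ρ i ^ b * m i j) (ρ i ^ b * ∑' j, ρ j ^ a * m i j) := by
    intro i
    refine ((hsm i).hasSum.mul_left (ρ i ^ b)).congr_fun fun j => ?_
    ring
  have hG : HasSum (fun i => ρ i ^ b * ∑' j, ρ j ^ a * m i j) (S₂ / L ^ N) := hF.prod_fiberwise hfib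
  have hg1 : ∀ i, |∑' j, ρ j ^ a * m i j| ≤ 1 := fun i => by
    obtain ⟨hs, hle1⟩ := hmrow i
    have h := tsum_of_norm_bounded (f := fun j => ρ j ^ a * m i j) hs.hasSum fun j => by
      rw [Real.norm_eq_abs, abs_mul, abs_of_nonneg (pow_nonneg (hρ0 j) a)]
      exact mul_le_of_le_one_left (abs_nonneg _) (hρa1 j)
    rw [Real.norm_eq_abs] at h
    exact h.trans hle1
  have he₁' : |S₂ / L ^ N - ∑' j, ρ j ^ a * m i₀ j| ≤ R := by
    obtain ⟨hsb', hoffb⟩ := hoff b le_rfl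
    exact abs_sub_le_of_hasSum_mul i₀ hρ0 hρi₀ hg1 hsb' hoffb hG
  -- the vacuum row: `g i₀ = m i₀ i₀ + O(θᵃ)`
  have hgi₀ : |(∑' j, ρ j ^ a * m i₀ j) - m i₀ i₀| ≤ θ ^ a := by
    obtain ⟨hs, hle1⟩ := hmrow i₀
    rw [(hsm i₀).tsum_eq_add_tsum_ite i₀, hρi₀, one_pow, one_mul, add_sub_cancel_left]
    have hθs : Summable fun j => θ ^ a * |m i₀ j| := hs.mul_left _
    refine abs_tsum_ite_le i₀ hθs (fun j hj => ?_) ?_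
    · rw [abs_mul, abs_of_nonneg (pow_nonneg (hρ0 j) a)]
      exact mul_le_mul_of_nonneg_right (pow_le_pow_left₀ (hρ0 j) (hρθ j hj) a) (abs_nonneg _)
    · calc ∑' j, (if j = i₀ then 0 else θ ^ a * |m i₀ j|) ≤ ∑' j, θ ^ a * |m i₀ j| :=
            Summable.tsum_le_tsum (fun j => by
              by_cases hj : j = i₀
              · simp only [hj, if_true]; exact mul_nonneg (pow_nonneg hθ0 a) (abs_nonneg _)
              · simp only [hj, if_false]; exact le_rfl) (summable_ite_zero i₀ hθs) hθs
        _ = θ ^ a * ∑' j, |m i₀ j| := tsum_mul_left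
        _ ≤ θ ^ a * 1 := mul_le_mul_of_nonneg_left hle1 (pow_nonneg hθ0 a)
        _ = θ ^ a := mul_one _
  have hmi₀ : m i₀ i₀ = (M₁ i₀ i₀ / P) * (M₂ i₀ i₀ / P) := by
    rw [hmdef]; dsimp only; rw [sq, div_mul_div_comm]
  -- the pure algebra
  set α₁ : ℝ := M₁ i₀ i₀ / P with hα₁
  set α₂ : ℝ := M₂ i₀ i₀ / P with hα₂
  have hα₁1 : |α₁| ≤ 1 := by rw [hα₁, abs_div, abs_of_pos hP0, div_le_one hP0]; exact hd₁ i₀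
  have hα₂1 : |α₂| ≤ 1 := by rw [hα₂, abs_div, abs_of_pos hP0, div_le_one hP0]; exact hd₂ i₀
  set s₂ : ℝ := S₂ / L ^ N with hs₂
  set s₁ : ℝ := S₁ / L ^ N with hs₁
  set s₁' : ℝ := S₁' / L ^ N with hs₁'
  have he₁ : |s₂ - α₁ * α₂| ≤ θ ^ a + R := by
    rw [← hmi₀]
    calc |s₂ - m i₀ i₀| = |(s₂ - ∑' j, ρ j ^ a * m i₀ j) + ((∑' j, ρ j ^ a * m i₀ j) - m i₀ i₀)| := by ring_nf
      _ ≤ |s₂ - ∑' j, ρ j ^ a * m i₀ j| + |(∑' j, ρ j ^ a * m i₀ j) - m i₀ i₀| := abs_add_le _ _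
      _ ≤ R + θ ^ a := add_le_add he₁' hgi₀
      _ = θ ^ a + R := add_comm _ _
  have hquot : S₂ / Z - S₁ / Z * (S₁' / Z) = s₂ / z - s₁ / z * (s₁' / z) := by
    rw [hs₂, hs₁, hs₁', hzdef, div_div_div_cancel_right₀ hLN.ne', div_div_div_cancel_right₀ hLN.ne',
      div_div_div_cancel_right₀ hLN.ne']
  have hz0 : z ≠ 0 := by positivity
  have hkey : s₂ / z - s₁ / z * (s₁' / z) =
      ((z - 1) * (α₁ * α₂) + z * (s₂ - α₁ * α₂) - α₁ * (s₁' - α₂) - α₂ * (s₁ - α₁) - (s₁ - α₁) * (s₁' - α₂)) /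
        z ^ 2 := by
    field_simp
    ring
  rw [hquot, hkey, abs_div, abs_of_pos (by positivity : (0 : ℝ) < z ^ 2)]
  have hz2 : 1 ≤ z ^ 2 := one_le_pow₀ hz1
  refine (div_le_self (abs_nonneg _) hz2).trans ?_
  -- term by term
  have hr : |z - 1| ≤ R := by rw [abs_of_nonneg (by linarith)]; linarith
  have t1 : |(z - 1) * (α₁ * α₂)| ≤ R := by
    rw [abs_mul, abs_mul]
    calc |z - 1| * (|α₁| * |α₂|) ≤ R * (1 * 1) := by gcongr
      _ = R := by ring
  have t2 : |z * (s₂ - α₁ * α₂)| ≤ 2 * θ ^ a + 2 * R := by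
    rw [abs_mul, abs_of_pos (by positivity : (0 : ℝ) < z)]
    calc z * |s₂ - α₁ * α₂| ≤ (1 + R) * (θ ^ a + R) := by gcongr
      _ ≤ 2 * (θ ^ a + R) := by gcongr; linarith
      _ = 2 * θ ^ a + 2 * R := by ring
  have t3 : |α₁ * (s₁' - α₂)| ≤ R := by
    rw [abs_mul]
    calc |α₁| * |s₁' - α₂| ≤ 1 * R := by gcongr
      _ = R := one_mul _
  have t4 : |α₂ * (s₁ - α₁)| ≤ R := by
    rw [abs_mul]
    calc |α₂| * |s₁ - α₁| ≤ 1 * R := by gcongr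
      _ = R := one_mul _
  have t5 : |(s₁ - α₁) * (s₁' - α₂)| ≤ R := by
    rw [abs_mul]
    calc |s₁ - α₁| * |s₁' - α₂| ≤ R * R := by gcongr
      _ ≤ R * 1 := by gcongr
      _ = R := mul_one _
  calc |(z - 1) * (α₁ * α₂) + z * (s₂ - α₁ * α₂) - α₁ * (s₁' - α₂) - α₂ * (s₁ - α₁) - (s₁ - α₁) * (s₁' - α₂)|
      ≤ |(z - 1) * (α₁ * α₂) + z * (s₂ - α₁ * α₂) - α₁ * (s₁' - α₂) - α₂ * (s₁ - α₁)| +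
          |(s₁ - α₁) * (s₁' - α₂)| := abs_sub _ _
    _ ≤ |(z - 1) * (α₁ * α₂) + z * (s₂ - α₁ * α₂) - α₁ * (s₁' - α₂)| + |α₂ * (s₁ - α₁)| +
          |(s₁ - α₁) * (s₁' - α₂)| := by gcongr; exact abs_sub _ _
    _ ≤ |(z - 1) * (α₁ * α₂) + z * (s₂ - α₁ * α₂)| + |α₁ * (s₁' - α₂)| + |α₂ * (s₁ - α₁)| +
          |(s₁ - α₁) * (s₁' - α₂)| := by gcongr; exact abs_sub _ _
    _ ≤ |(z - 1) * (α₁ * α₂)| + |z * (s₂ - α₁ * α₂)| + |α₁ * (s₁' - α₂)| + |α₂ * (s₁ - α₁)| +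
          |(s₁ - α₁) * (s₁' - α₂)| := by gcongr; exact abs_add_le _ _
    _ ≤ R + (2 * θ ^ a + 2 * R) + R + R + R := by gcongr
    _ = 2 * θ ^ a + 6 * R := by ring

end Literature.Analysis.OperatorTheory

end
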